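import Literature.NumberTheory.EllipticCurves.QuarticTwistHeckeCoefficients
import HarnessLib

/-!
# `L(E_D ⊗ c, s) = ¼ · Θ-L(Ψ_{D,c}, s)`: the twisted `L`-series of `y² = x³ − Dx` as a weight-one theta `L`-series of `ℤ[i]`

Topic `Literature/NumberTheory/EllipticCurves`, namespace `Literature.NumberTheory.EllipticCurves.QuarticTwist`.
Theorems only (no definition, no named fact).  Ireland–Rosen's Theorem 18.7 «`L(E, s) = L(s, χ)`» with the continuation
of Theorem 18.6 (Hecke: «`L(s, χ)` can be analytically continued to an entire function»), in the concrete form of the tree's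
weight-one theta series `LFunctions.GaussianTheta.thetaLFunction` (Koblitz Ch. II §5) — the `D`-general twin of
`CongruentNumberCurveHeckeSeries.hasEntireLFunction_congruentNumberCurve_of_squarefree` (`D = n²`, `ψ_n = (n/N x) u(x)`), and
twisted by an arbitrary function `c` of the norm modulo `m` (for the Birch–Manin twists `c = χ̄`).

The coefficient.  For `D ≠ 0` free of fourth powers, `m ∈ ℕ`, `c : ℤ/m → ℂ` and a "unit weight" `e : ℤ[i] → ℤ[i]` with `e(0) = 0`,
`Ψ(x) = 𝟙[(N x, D) = 1] · \overline{(D/x)₄} · e(u(x)) · c(N x)`, `u(x)` the unit with `u(x) x` primary (`0` for `1 + i ∣ x`):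

* `thetaWeight_periodic` — `Ψ` is periodic modulo `8|D|m` (`(D/·)₄` has modulus `8D`, Ch. 18 §6, proof of Theorem 7:
  `quarticSymbolInt_eq_of_dvd_sub`; `u(·)` depends on `x mod 4`; `N(x) mod m`);
* `isIntegral_thetaWeight` — its values are algebraic integers when those of `c` are;
* `coeff_thetaWeight` — for `e = id`: **`Σ_{N x = n} Ψ(x) x = 4 c(n) a_n(E_D)`** (Theorem 18.7 coefficientwise,
  `lFunction_eq_sum_primaryNormEq`, and each primary `x̃` has the four associates `x`, `Ψ(x) x = \overline{(D/x̃)₄} x̃ c(n)`);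
* `lSeries_twist_eq_thetaLFunction` — **`Σ_n c(n) a_n(E_D) n^{-s} = ¼ · thetaLFunction (8|D|m) Ψ s`** for `Re s > 3/2`, whence an
  entire continuation (`exists_differentiable_twist`), Theorem 18.6 for these characters;
* `thetaWeight_three_split` — for `D = (-3)^k D₁`, `k ≥ 1`: `Ψ_D(x) = \overline{(x/3)₄}^k · Ψ'(x)` with `Ψ'` the weight for `D₁` and
  the unit weight `e(u) = \overline{(u/3)₄}^k u` (`(-3/x̃)₄ = (x̃/3)₄`, Prop. 9.9.8, `quarticSymbolInt_neg_three_pow_mul_of_isPrimary`), i.e.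
  the prime `3` of `D` appears in the theta coefficient exactly as the quartic character `\overline{(·/3)₄}^k` modulo `3`.

## References
* K. Ireland, M. Rosen, *A Classical Introduction to Modern Number Theory*, 2nd ed., GTM 84 (1990), Ch. 18 §5 Theorem 6, §6 Theorem 7
  (PDF pp. 302–304); Ch. 9 §9 Prop. 9.9.8. [IrelandRosen1990]
* N. Koblitz, *Introduction to Elliptic Curves and Modular Forms*, GTM 97 (1993), Ch. II §5 (theta continuation). [Koblitz1993]

## Mathlib / tree search
Tree: `GaussianTheta.{coeff, normEq, mem_normEq, thetaLFunction, thetaLFunction_eq_LSeries, differentiable_thetaLFunction}`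
(`LFunctions/GaussianThetaSeries`); `GaussianPrimary.{primaryUnit, primary_eq_primaryUnit_mul, primaryUnit_add_natCast_mul,
primaryUnit_eq_zero_of_even, norm_add_natCast_mul_emod, units4, card_units4, filter_primary_eq_image}` (`CongruentNumberCurveHeckeSeries`);
`QuarticTwist.lFunction_eq_sum_primaryNormEq`, `lFunction_apply_prime_pow_of_dvd` (this cluster); `quarticSymbolInt_*`, `quarticCharThree_*`
(`QuadraticFields/GaussianQuarticSymbol[Values]`).  Mathlib: `LSeries`, `LSeries_congr`, `Nat.exists_eq_pow_mul_and_not_dvd`.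
-/

noncomputable section

open scoped Classical

namespace Literature.NumberTheory.EllipticCurves

namespace QuarticTwist

open WeierstrassCurve Complex
open Literature.NumberTheory.QuadraticFields.GaussianPrimary Literature.NumberTheory.QuadraticFields.GaussianQuarticSymbol
open Literature.NumberTheory.EllipticCurves.GaussianPrimary Literature.NumberTheory.LFunctions

variable {D : ℤ} {m : ℕ}

/-! ### §1 The theta coefficient `Ψ` and its period `8|D|m` -/

/-- The parity of `x + M y` is that of `x` for even `M`. [folklore] -/
private theorem parity_add_natCast_mul {M : ℕ} (hM : 2 ∣ M) (x y : GaussianInt) :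
    ((x + (M : GaussianInt) * y).re + (x + (M : GaussianInt) * y).im) % 2 = (x.re + x.im) % 2 := by
  obtain ⟨k, rfl⟩ := hM
  have h : (x + ((2 * k : ℕ) : GaussianInt) * y).re + (x + ((2 * k : ℕ) : GaussianInt) * y).im =
      (x.re + x.im) + 2 * (k * y.re + k * y.im) := by
    simp only [Zsqrtd.re_add, Zsqrtd.im_add, Zsqrtd.re_mul, Zsqrtd.im_mul, Zsqrtd.re_natCast, Zsqrtd.im_natCast,
      zero_mul, mul_zero, add_zero]
    push_cast
    ring
  rw [h, Int.add_mul_emod_self_left]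

/-- An odd Gaussian integer whose norm is prime to `D` is coprime to `8D` in `ℤ[i]`. [cite: IrelandRosen1990, Ch. 18 §6 («`A` relatively prime to `2D`»)] -/
private theorem isCoprime_eight_mul {x : GaussianInt} (hodd : (x.re + x.im) % 2 = 1) (hcop : IsCoprime x.norm D) :
    IsCoprime x ((8 * D : ℤ) : GaussianInt) := by
  refine isCoprime_of_isCoprime_norm (IsCoprime.mul_right ?_ hcop)
  have h2 : x.norm % 2 = 1 := by rw [norm_emod_two]; exact hodd
  rw [show (8 : ℤ) = 2 ^ 3 by norm_num]
  exact IsCoprime.pow_right ⟨1, -(x.norm / 2), by omega⟩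

/-- **The theta coefficient has period `8|D|m`.**  For `D ≠ 0`, any `m`, any `c : ℤ/m → ℂ` and any unit weight `e` with `e 0 = 0`, the
function `Ψ(x) = 𝟙[(N x, D) = 1] \overline{(D/x)₄} e(u(x)) c(N x)` satisfies `Ψ(x + 8|D|m·y) = Ψ(x)`: the twist `(D/·)₄` is a character
modulo `(8D)` (Ireland–Rosen Ch. 18 §6: «`α ≡ 1 (8D)` implies `(D/α)₄ = 1`»), the unit `u(x)` depends on `x mod (2 + 2i)`, and
`N(x + My) ≡ N(x) (mod M)`. [cite: IrelandRosen1990, Ch. 18 §6, Theorem 7 («algebraic Hecke character … for the modulus `(8D)`»)] -/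
theorem thetaWeight_periodic (hD : D ≠ 0) (e : GaussianInt → GaussianInt) (he : e 0 = 0) (c : ZMod m → ℂ)
    {Ψ : GaussianInt → ℂ}
    (hΨ : ∀ x, Ψ x = (if IsCoprime x.norm D then ((star (quarticSymbolInt D x) * e (primaryUnit x) : GaussianInt) : ℂ) else 0) *
      c (x.norm : ZMod m))
    (x y : GaussianInt) : Ψ (x + ((8 * D.natAbs * m : ℕ) : GaussianInt) * y) = Ψ x := by
  set M : ℕ := 8 * D.natAbs * m with hMdef
  have hMD : (D : ℤ) ∣ (M : ℤ) := by
    rw [hMdef]; push_cast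
    exact ((self_dvd_abs D).mul_left 8).mul_right _
  have hMm : (m : ℤ) ∣ (M : ℤ) := by rw [hMdef]; push_cast; exact dvd_mul_left _ _
  have hM4 : 4 ∣ M := ⟨2 * D.natAbs * m, by rw [hMdef]; ring⟩
  have hM2 : 2 ∣ M := (show (2 : ℕ) ∣ 4 by norm_num).trans hM4
  have hnorm : (x + (M : GaussianInt) * y).norm % M = x.norm % M := norm_add_natCast_mul_emod M x y
  have hmodeq : (x + (M : GaussianInt) * y).norm ≡ x.norm [ZMOD M] := hnorm
  -- the three periodic ingredients
  have hc : c ((x + (M : GaussianInt) * y).norm : ZMod m) = c (x.norm : ZMod m) := by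
    rw [(ZMod.intCast_eq_intCast_iff _ _ _).mpr (hmodeq.of_dvd hMm)]
  have hcop : IsCoprime (x + (M : GaussianInt) * y).norm D ↔ IsCoprime x.norm D := by
    obtain ⟨t, ht⟩ := (hmodeq.of_dvd hMD).symm.dvd
    -- `N(x + My) = N(x) + D t`
    have : (x + (M : GaussianInt) * y).norm = x.norm + D * t := by linear_combination ht
    rw [this]
    exact ⟨fun h ↦ h.of_add_mul_left_left, fun h ↦ h.add_mul_left_left t⟩
  have hu : primaryUnit (x + (M : GaussianInt) * y) = primaryUnit x := primaryUnit_add_natCast_mul hM4 x y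
  rw [hΨ, hΨ, hc, hu]
  by_cases hcx : IsCoprime x.norm D
  · rw [if_pos hcx, if_pos (hcop.mpr hcx)]
    by_cases hodd : (x.re + x.im) % 2 = 1
    · -- odd `x` prime to `D`: the symbol is periodic modulo `8D ∣ M`
      have hx0 : x ≠ 0 := by rintro rfl; simp at hodd
      have hodd' : ((x + (M : GaussianInt) * y).re + (x + (M : GaussianInt) * y).im) % 2 = 1 := by
        rw [parity_add_natCast_mul hM2]; exact hodd
      have hx0' : x + (M : GaussianInt) * y ≠ 0 := by rintro h; rw [h] at hodd'; simp at hodd'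
      rw [quarticSymbolInt_eq_of_dvd_sub hD hx0' hx0 (isCoprime_eight_mul hodd hcx) ?_]
      rw [add_sub_cancel_left]
      have h8 : (8 * D : ℤ) ∣ (M : ℤ) := by
        rw [hMdef]; push_cast
        exact (mul_dvd_mul_left 8 (self_dvd_abs D)).mul_right _
      have h8' : ((8 * D : ℤ) : GaussianInt) ∣ (M : GaussianInt) := by
        simpa using map_dvd (Int.castRingHom GaussianInt) h8
      exact h8'.mul_right y
    · -- even `x`: `u(x) = u(x + My) = 0`
      rw [primaryUnit_eq_zero_of_even (by omega), he, mul_zero, mul_zero]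
  · rw [if_neg hcx, if_neg (fun h ↦ hcx (hcop.mp h))]

/-- Gaussian integers are algebraic integers in `ℂ`. [cite: IrelandRosen1990, Ch. 1 §4 («`ℤ[i]` is a ring»)] -/
theorem isIntegral_toComplex (z : GaussianInt) : IsIntegral ℤ (z : ℂ) := by
  have hI : IsIntegral ℤ Complex.I := by
    refine ⟨Polynomial.X ^ 2 + 1, Polynomial.monic_X_pow_add_C _ (by norm_num), ?_⟩
    simp [Polynomial.eval₂_add, Polynomial.eval₂_pow]
  have hre : IsIntegral ℤ ((z.re : ℤ) : ℂ) := by simpa using isIntegral_algebraMap (R := ℤ) (A := ℂ) (x := z.re)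
  have him : IsIntegral ℤ ((z.im : ℤ) : ℂ) := by simpa using isIntegral_algebraMap (R := ℤ) (A := ℂ) (x := z.im)
  rw [GaussianInt.toComplex_def]
  exact hre.add (him.mul hI)

/-- **The theta coefficient takes algebraic-integer values** when `c` does (`\overline{(D/x)₄} e(u(x)) ∈ ℤ[i]`).
[cite: IrelandRosen1990, Ch. 18 §6 (the values `\overline{(D/π)₄} ∈ {±1, ±i}`)] -/
theorem isIntegral_thetaWeight (e : GaussianInt → GaussianInt) {c : ZMod m → ℂ} (hc : ∀ a, IsIntegral ℤ (c a))
    {Ψ : GaussianInt → ℂ}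
    (hΨ : ∀ x, Ψ x = (if IsCoprime x.norm D then ((star (quarticSymbolInt D x) * e (primaryUnit x) : GaussianInt) : ℂ) else 0) *
      c (x.norm : ZMod m))
    (x : GaussianInt) : IsIntegral ℤ (Ψ x) := by
  rw [hΨ]
  refine IsIntegral.mul ?_ (hc _)
  split_ifs
  · exact isIntegral_toComplex _
  · exact isIntegral_zero

/-! ### §2 The coefficients: `Σ_{N x = n} Ψ(x) x = 4 c(n) a_n(E_D)` -/

/-- `Σ_{N x = n} g(x̃) = 4 Σ_{x̃ primary, N x̃ = n} g(x̃)` for any `g` with `g(0) = 0`: every primary element of norm `n` is the primary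
associate of exactly its four associates, and the `x` divisible by `1 + i` have `x̃ = 0` (the tree's `sum_normEq_primary` is `g = id`).
[cite: IrelandRosen1990, Ch. 9 §7, Lemma 7 («a unique unit `u` such that `uα` is primary»)] -/
theorem sum_normEq_comp_primary {M' : Type*} [AddCommMonoid M'] (g : GaussianInt → M') (hg : g 0 = 0) (n : ℕ) :
    ∑ x ∈ GaussianTheta.normEq n, g (primary x) = 4 • ∑ y ∈ primaryNormEq n, g y := by
  classical
  have hmaps : ∀ x ∈ GaussianTheta.normEq n, primary x ∈ insert 0 (primaryNormEq n) := by
    intro x hx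
    rw [GaussianTheta.mem_normEq] at hx
    rw [Finset.mem_insert, mem_primaryNormEq]
    by_cases hodd : (x.re + x.im) % 2 = 1
    · exact Or.inr ⟨by rw [norm_primary hodd, hx], isPrimary_primary hodd⟩
    · exact Or.inl (primary_eq_zero_of_even (by omega))
  have h0P : (0 : GaussianInt) ∉ primaryNormEq n := by
    rw [mem_primaryNormEq, not_and]; exact fun _ h ↦ h.ne_zero rfl
  rw [← Finset.sum_fiberwise_of_maps_to hmaps, Finset.sum_insert h0P]
  have h0 : ∑ x ∈ (GaussianTheta.normEq n).filter (fun x ↦ primary x = 0), g (primary x) = 0 :=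
    Finset.sum_eq_zero fun x hx ↦ by rw [(Finset.mem_filter.mp hx).2, hg]
  rw [h0, zero_add, Finset.smul_sum]
  refine Finset.sum_congr rfl fun y hy ↦ ?_
  have hyp := (mem_primaryNormEq.mp hy).2
  rw [Finset.sum_congr rfl (fun x hx ↦ by rw [(Finset.mem_filter.mp hx).2]), Finset.sum_const,
    filter_primary_eq_image hy, Finset.card_image_of_injective _ (mul_left_injective₀ hyp.ne_zero), card_units4]

/-- `a_n(E_D) = 0` unless `(n, D) = 1` (some `p ∣ (n, D)` is an additive prime, and `a` is multiplicative).
[cite: IrelandRosen1990, Ch. 18 §6 («If `P` divides `2D` define `χ(P) = 0`»)] -/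
theorem lFunction_eq_zero_of_not_isCoprime (hD : D ≠ 0) (hD4 : ∀ p : ℕ, p.Prime → ¬ (p : ℤ) ^ 4 ∣ D) {n : ℕ} (hn : n ≠ 0)
    (h : ¬ IsCoprime (n : ℤ) D) : (⟨0, 0, 0, -(D : ℚ), 0⟩ : WeierstrassCurve ℚ).LFunction n = 0 := by
  rw [Int.isCoprime_iff_gcd_eq_one] at h
  obtain ⟨p, hp, hpdvd⟩ := Nat.exists_prime_and_dvd h
  have hpn : p ∣ n := by
    have := (Int.natCast_dvd_natCast.mpr hpdvd).trans (Int.gcd_dvd_left (n : ℤ) D); exact_mod_cast this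
  have hpD : (p : ℤ) ∣ D := (Int.natCast_dvd_natCast.mpr hpdvd).trans (Int.gcd_dvd_right (n : ℤ) D)
  obtain ⟨k, n', hn', rfl⟩ := Nat.exists_eq_pow_mul_and_not_dvd hn p hp.ne_one
  have hk : k ≠ 0 := by
    rintro rfl
    rw [pow_zero, one_mul] at hpn; exact hn' hpn
  obtain ⟨k', rfl⟩ : ∃ k', k = k' + 1 := ⟨k - 1, by omega⟩
  have hcop : (p ^ (k' + 1)).Coprime n' := (Nat.Coprime.pow_left _ ((Nat.Prime.coprime_iff_not_dvd hp).mpr hn'))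
  rw [(⟨0, 0, 0, -(D : ℚ), 0⟩ : WeierstrassCurve ℚ).isMultiplicative_LFunction.map_mul_of_coprime hcop,
    lFunction_apply_prime_pow_of_dvd hD hp (hpD.mul_left 2) (hD4 p hp) k', zero_mul]

/-- **`Σ_{N x = n} Ψ(x) x = 4 c(n) a_n(E_D)`** for the coefficient with unit weight `e = id` (`D ≠ 0` free of fourth powers): the
`L`-series coefficients of the theta series `θ_Ψ` are `4 c(n) a_n(E_D)` — Ireland–Rosen's `L(E, s) = L(s, χ) = Σ_A χ(A) NA^{-s}`,
each ideal `A = (x̃)` counted once through its four generators `x` (`Ψ(x) x = \overline{(D/x̃)₄} x̃ c(N x)`).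
[cite: IrelandRosen1990, Ch. 18 §6, Theorem 7 («`L(E, s) = L(s, χ)`»)] -/
theorem coeff_thetaWeight (hD : D ≠ 0) (hD4 : ∀ p : ℕ, p.Prime → ¬ (p : ℤ) ^ 4 ∣ D) (c : ZMod m → ℂ)
    {Ψ : GaussianInt → ℂ}
    (hΨ : ∀ x, Ψ x = (if IsCoprime x.norm D then ((star (quarticSymbolInt D x) * primaryUnit x : GaussianInt) : ℂ) else 0) *
      c (x.norm : ZMod m)) (n : ℕ) :
    GaussianTheta.coeff Ψ n = 4 * c (n : ZMod m) * ((⟨0, 0, 0, -(D : ℚ), 0⟩ : WeierstrassCurve ℚ).LFunction n : ℂ) := by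
  rcases eq_or_ne n 0 with rfl | hn
  · simp [ArithmeticFunction.map_zero]
  rw [GaussianTheta.coeff]
  -- every `x` of norm `n` contributes `𝟙 · c(n) · \overline{(D/x̃)₄} x̃`
  have hterm : ∀ x ∈ GaussianTheta.normEq n, Ψ x * (x : ℂ) =
      (if IsCoprime (n : ℤ) D then c (n : ZMod m) else 0) *
        ((star (quarticSymbolInt D (primary x)) * primary x : GaussianInt) : ℂ) := by
    intro x hx
    have hxn : x.norm = n := GaussianTheta.mem_normEq.mp hx
    rw [hΨ, hxn, Int.cast_natCast]
    have key : ((star (quarticSymbolInt D x) * primaryUnit x : GaussianInt) : ℂ) * (x : ℂ) =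
        ((star (quarticSymbolInt D (primary x)) * primary x : GaussianInt) : ℂ) := by
      rw [← map_mul, mul_assoc, ← primary_eq_primaryUnit_mul]
      by_cases hodd : (x.re + x.im) % 2 = 1
      · rw [quarticSymbolInt_primary D hodd]
      · rw [primary_eq_zero_of_even (by omega), mul_zero, mul_zero]
    split_ifs with h
    · rw [mul_right_comm, key, mul_comm]
    · simp
  rw [Finset.sum_congr rfl hterm, ← Finset.mul_sum, ← map_sum GaussianInt.toComplex,
    sum_normEq_comp_primary (fun y ↦ star (quarticSymbolInt D y) * y) (by simp) n, map_nsmul,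
    ← lFunction_eq_sum_primaryNormEq hD hD4 hn, map_intCast]
  split_ifs with h
  · rw [nsmul_eq_mul]; push_cast; ring
  · rw [lFunction_eq_zero_of_not_isCoprime hD hD4 hn h]; simp

/-! ### §3 The `L`-series identity and the entire continuation -/

/-- **`Σ_n c(n) a_n(E_D) n^{-s} = ¼ · Θ-L_{8|D|m}(Ψ)(s)` for `Re s > 3/2`** — Ireland–Rosen's «`L(E, s) = L(s, χ)`» twisted by `c(N·)`, with
the Hecke series realised as the tree's weight-one theta `L`-series of `ℤ[i]` of the periodic coefficient `Ψ` (`D ≠ 0` free of fourth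
powers). [cite: IrelandRosen1990, Ch. 18 §6, Theorem 7; Ch. 18 §5, Theorem 6 (continuation)] -/
theorem lSeries_twist_eq_thetaLFunction (hD : D ≠ 0) (hD4 : ∀ p : ℕ, p.Prime → ¬ (p : ℤ) ^ 4 ∣ D) [NeZero m]
    (c : ZMod m → ℂ) {Ψ : GaussianInt → ℂ}
    (hΨ : ∀ x, Ψ x = (if IsCoprime x.norm D then ((star (quarticSymbolInt D x) * primaryUnit x : GaussianInt) : ℂ) else 0) *
      c (x.norm : ZMod m)) {s : ℂ} (hs : 3 / 2 < s.re) :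
    haveI : NeZero (8 * D.natAbs * m) := ⟨by positivity [Int.natAbs_ne_zero.mpr hD, NeZero.ne m]⟩
    LSeries (fun n : ℕ ↦ c (n : ZMod m) * ((⟨0, 0, 0, -(D : ℚ), 0⟩ : WeierstrassCurve ℚ).LFunction n : ℂ)) s =
      (1 / 4 : ℂ) * GaussianTheta.thetaLFunction (8 * D.natAbs * m) Ψ s := by
  haveI : NeZero (8 * D.natAbs * m) := ⟨by positivity [Int.natAbs_ne_zero.mpr hD, NeZero.ne m]⟩
  rw [GaussianTheta.thetaLFunction_eq_LSeries (8 * D.natAbs * m) Ψ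
    (thetaWeight_periodic hD id rfl c hΨ) hs, LSeries, LSeries, ← tsum_mul_left]
  congr 1
  funext n
  simp only [LSeries.term]
  split_ifs with hn
  · rw [mul_zero]
  · rw [coeff_thetaWeight hD hD4 c hΨ n]
    field_simp

/-- **Hecke–Ireland–Rosen continuation (Theorem 18.6 for `χ_D · c∘N`)**: `Σ_n c(n) a_n(E_D) n^{-s}` is the restriction to
`Re s > 3/2` of the entire function `¼ · thetaLFunction (8|D|m) Ψ`. [cite: IrelandRosen1990, Ch. 18 §5, Theorem 6; Ch. 18 §6, Theorem 7] -/
theorem exists_differentiable_twist (hD : D ≠ 0) (hD4 : ∀ p : ℕ, p.Prime → ¬ (p : ℤ) ^ 4 ∣ D) [NeZero m] (c : ZMod m → ℂ) :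
    ∃ L : ℂ → ℂ, Differentiable ℂ L ∧ ∀ s : ℂ, 3 / 2 < s.re →
      L s = LSeries (fun n : ℕ ↦ c (n : ZMod m) * ((⟨0, 0, 0, -(D : ℚ), 0⟩ : WeierstrassCurve ℚ).LFunction n : ℂ)) s := by
  haveI : NeZero (8 * D.natAbs * m) := ⟨by positivity [Int.natAbs_ne_zero.mpr hD, NeZero.ne m]⟩
  set Ψ : GaussianInt → ℂ := fun x ↦
    (if IsCoprime x.norm D then ((star (quarticSymbolInt D x) * primaryUnit x : GaussianInt) : ℂ) else 0) * c (x.norm : ZMod m)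
  refine ⟨fun s ↦ (1 / 4 : ℂ) * GaussianTheta.thetaLFunction (8 * D.natAbs * m) Ψ s,
    (GaussianTheta.differentiable_thetaLFunction _ _).const_mul _, fun s hs ↦ ?_⟩
  exact (lSeries_twist_eq_thetaLFunction hD hD4 c (Ψ := Ψ) (fun _ ↦ rfl) hs).symm

/-! ### §4 The prime `3`: `Ψ_D = \overline{(·/3)₄}^k · Ψ'` for `D = (-3)^k D₁` -/

/-- `3 ∣ N(x)` iff `3 ∣ x` in `ℤ[i]` (`3` is inert). [cite: IrelandRosen1990, Ch. 9 §7, Lemma 4] -/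
theorem three_dvd_norm_iff (x : GaussianInt) : (3 : ℤ) ∣ x.norm ↔ (3 : GaussianInt) ∣ x := by
  have h3 : Prime (3 : GaussianInt) := by
    simpa using (GaussianInt.prime_iff_mod_four_eq_three_of_nat_prime 3).mpr (by norm_num)
  constructor
  · intro h
    have h' : (3 : GaussianInt) ∣ (x.norm : GaussianInt) := by
      obtain ⟨k, hk⟩ := h; exact ⟨k, by rw [hk]; push_cast; ring⟩
    rw [cast_norm_eq] at h'
    rcases h3.dvd_or_dvd h' with h | h
    · exact h
    · obtain ⟨k, hk⟩ := h
      exact ⟨star k, by rw [← star_star x, hk, star_mul', show star (3 : GaussianInt) = 3 by decide]⟩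
  · rintro ⟨k, rfl⟩
    rw [Zsqrtd.norm_mul]
    exact Dvd.dvd.mul_right ⟨3, by decide⟩ _

/-- **The `3`-part of the theta coefficient.**  For `D = (-3)^k · D₁` with `k ≥ 1` and any `c`: the coefficient `Ψ_D` (unit weight
`id`) factors as `Ψ_D(x) = \overline{(x/3)₄}^k · Ψ'(x)`, where `Ψ'` is the coefficient for `D₁` with unit weight `e(u) = \overline{(u/3)₄}^k u`
(`(D/x̃)₄ = (x̃/3)₄^k (D₁/x̃)₄` by Prop. 9.9.8 for `a = -3`, and `(x̃/3)₄ = (u/3)₄ (x/3)₄` for `x̃ = u x`; for `3 ∣ x` both sides vanish).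
[cite: IrelandRosen1990, Ch. 9 §9, Prop. 9.9.8; Ch. 18 §6, Theorem 7] -/
theorem thetaWeight_three_split {k : ℕ} (hk : k ≠ 0) (D₁ : ℤ) (hD : D = (-3) ^ k * D₁) (c : ZMod m → ℂ)
    {Ψ Ψ' : GaussianInt → ℂ}
    (hΨ : ∀ x, Ψ x = (if IsCoprime x.norm D then ((star (quarticSymbolInt D x) * primaryUnit x : GaussianInt) : ℂ) else 0) *
      c (x.norm : ZMod m))
    (hΨ' : ∀ x, Ψ' x = (if IsCoprime x.norm D₁ then
      ((star (quarticSymbolInt D₁ x) * (star (quarticCharThree (primaryUnit x)) ^ k * primaryUnit x) : GaussianInt) : ℂ) else 0) *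
      c (x.norm : ZMod m))
    (x : GaussianInt) : Ψ x = ((star (quarticCharThree x) : GaussianInt) : ℂ) ^ k * Ψ' x := by
  rw [hΨ, hΨ']
  by_cases h3 : (3 : GaussianInt) ∣ x
  · -- both sides vanish
    have hq : quarticCharThree x = 0 := (quarticCharThree_eq_zero_iff x).mpr h3
    have hncop : ¬ IsCoprime x.norm D := by
      intro h
      rw [hD] at h
      have h' : IsCoprime x.norm 3 :=
        (IsCoprime.neg_right_iff _ _).mp ((IsCoprime.pow_right_iff (Nat.pos_of_ne_zero hk)).mp h.of_mul_right_left)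
      have h33 : IsCoprime (3 : ℤ) 3 := h'.of_isCoprime_of_dvd_left ((three_dvd_norm_iff x).mpr h3)
      have := isCoprime_self.mp h33
      norm_num [Int.isUnit_iff] at this
    rw [if_neg hncop, hq, star_zero, map_zero, zero_pow hk, zero_mul, zero_mul]
  · have h3n : ¬ (3 : ℤ) ∣ x.norm := fun h ↦ h3 ((three_dvd_norm_iff x).mp h)
    have hcop3 : IsCoprime x.norm ((-3) ^ k) :=
      IsCoprime.pow_right ((Int.prime_three.coprime_iff_not_dvd.mpr h3n).symm.neg_right)
    have hiff : IsCoprime x.norm D ↔ IsCoprime x.norm D₁ := by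
      rw [hD]; exact ⟨fun h ↦ h.of_mul_right_right, fun h ↦ IsCoprime.mul_right hcop3 h⟩
    by_cases hcop : IsCoprime x.norm D
    · rw [if_pos hcop, if_pos (hiff.mp hcop)]
      by_cases hodd : (x.re + x.im) % 2 = 1
      · have hprim : IsPrimary (primary x) := isPrimary_primary hodd
        obtain ⟨u, hu, hux⟩ := exists_isUnit_primary_eq hodd
        have hux' : primary x = primaryUnit x * x := primary_eq_primaryUnit_mul x
        -- `(D/x)₄ = (D/x̃)₄ = (x̃/3)₄^k (D₁/x̃)₄ = ((u/3)₄ (x/3)₄)^k (D₁/x)₄`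
        have key : quarticSymbolInt D x = (quarticCharThree (primaryUnit x) * quarticCharThree x) ^ k * quarticSymbolInt D₁ x := by
          rw [← quarticSymbolInt_primary D hodd, hD, quarticSymbolInt_neg_three_pow_mul_of_isPrimary k D₁ hprim,
            quarticSymbolInt_primary D₁ hodd, hux', quarticCharThree_mul]
        rw [key, star_mul, star_pow, star_mul, mul_pow]
        simp only [map_mul, map_pow]
        ring
      · rw [primaryUnit_eq_zero_of_even (by omega)]
        simp
    · simp only [if_neg hcop, if_neg (fun h ↦ hcop (hiff.mpr h)), zero_mul, mul_zero]

end QuarticTwist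

end Literature.NumberTheory.EllipticCurves

end
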